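import Literature.MathematicalPhysics.QuantumFieldTheory.Balaban1983to89.Node00.Record10Carriers
import Literature.MathematicalPhysics.QuantumFieldTheory.Balaban1983to89.B13ResidualSlotProbe9
import Summits.QuantumFields.YangMills.Theorems.BalabanUVNodesN07RecordCensus
import Summits.QuantumFields.YangMills.Theorems.BalabanUVNodesN06AtRecord9CB10Y

/-!
# BalabanUVNodes ∕ N07 ([B11], `Dag.B11_main`) AT THE CUMULATIVE CARRIER PIN — the K3 stub `YMDAG.UVSplit.S_N07 Rec := AtRecord Rec Dag.B11_main` (`…ClustersCore` :201)
# READ AT NODE 00's records `Node00.IsRecordOfRecord₁₀CB10YZ` (newest storey, node00-def g30 `Node00/Record10Carriers` p430553) and `Node00.IsRecordOfRecord₉CB10YZ`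
# (`Node00/CarriersZ` p429835), where the world's [B11] bundle IS `Z11OfRecord F N ζ` — Theorem 1's family = `B11Thm1CarrierT.varProblemT` AT NODE 00's OBJECTS:
# READINGS · KEYED CLOSERS · THE KNIT AT THE BUNDLE OF RECORD («Thm 1 ⇐ Props 7, 8, Sect. F», dictionary reduced at objects) · CENSUS (∀-form junk-refutable through `ResidZ`)

Track A of `YM-PLAN.md` (cell `pub-ymgap`, HUMAN RULING D-0062), node **N07** = [Balaban1985Variational] Thm 1 p. 279 + Props 2–9 pp. 281–309; seat
`pub-ymgap-dag-n07-a` (generation 3; -a KNIT-BY-NAME; dag-lead REACTIVATE №7, trigger (t1) of `HANDOFF-dag-n07-a` §g2.6); sibling of this seat's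
`BalabanUVNodesN07RecordCensus` (p418004: the stub at ₅C ∕ ₈C, [B11] group unconstrained).  CONTENT consumed BY NAME, nothing restated: node00-def g30
(`CarriersZ`, `Record10Carriers`), def-T (`Record10`), this seat's `B11Thm1CarrierT ∕ …Reg ∕ …LevelZero`, `B11LeafUnpinnedRecord`, n10-a's `B13ResidualSlotProbe9`
(Stage-9 blindness to `X Y Z`), n22-b's `BalabanUVNodesN06AtRecord9CB10Y.exists_junkOps_b9LeafX_Y9OfRecord` (def-Y's junk operator layer), r2's
`B11.thm1_of_prop7_prop8_sectF` (print's own proof DAG).  THEOREMS ONLY (0 `def`, 0 `sorry`, standard axioms); COUNT-NEUTRAL; `--supports stmt-QuantumFields-19183`.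

THE STUB AT THESE RECORDS.  `S_N07 Rec := ∀ F D w, Rec F D w → ∀ P, Dag.B11_main (leavesP w P)`, `Dag.B11_main ℓ := b5 → b6 → b7 → b8 → b9 → b11`.  At such a record
`b5 b6 b7` are theorems of the record, `b9` IS def-Y's leaf `B9LeafX (Y9OfRecord …)` at a RESIDUAL operator layer, `b8` reads the RESIDUAL [B8] group `X`, and `b11` IS
`B11Leaf (Z11OfRecord F N ζ)` for the presenting RESIDUAL [B11] layer `ζ : ResidZ F N` ((9)–(10)'s data `R`, criticality predicate, Props 2–6 ∕ 9 families, constants).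
* §1 READINGS (₁₀CB10YZ): `b11_main_iff_leaves_of_isRecordOfRecord₁₀CB10YZ` (N07 at a run ⟺ `b8 → b9 → b11`), `s_N07_iff_leaves₁₀CB10YZ`,
  **`b11Leaf_Z11OfRecord_iff`** — the leaf at the bundle of record IS «Theorem 1 at NODE 00's objects over the whole family `ZIdx`, ONE block of constants» ∧ the
  nine Props ∕ Sect.-F statements over the residual families.
* §2 KEYED CLOSERS: `s_N07_record₁₀CB10YZ_of_leafSlot ∕ _of_bundleSlot` (package ∕ bundle form; §4: the bundle hypothesis is FALSE — the ∀-form is NOT a target),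
  `s_N07_of_refines₁₀CB10YZ_of_leaf` (REPAIR SHAPE one storey up: a `Rec` refining ₁₀CB10YZ at which the world's `b11` holds — what a further pin of `R` by genuine
  cubes + Theorem 1 PROVED supplies), `thm1At_varProblemT_of_letters` ((8) in def-B's Stage-₈ currency `UkExistsR … (regB11 …)`, F7 bridge backwards),
  `G8a_of_s_N07` (what `S_N07 Rec` FEEDS the Stage-₈ layer where the in-edge leaves hold: `UkExistsR ∧ UniqueUkOrbitR` at `regB11`).
* §3 THE KNIT AT THE BUNDLE OF RECORD: **`laws_famXOfRecord`** — print's dictionary `B11.VarProblemX.Laws` REDUCED AT OBJECTS (monotonicity of (2)'s class,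
  restriction of a minimiser, the orbit clause are THEOREMS; residual: «minimal ⇒ critical» for `ζ.IsCrit` and the local-minimum half of the restriction law,
  D-B11-2); **`b11Leaf_Z11OfRecord_of_parts`** — the leaf from NINE printed parts + those two laws, THEOREM 1 DERIVED (`B11.thm1_of_prop7_prop8_sectF`, p. 281 ∕
  p. 304) because the bundle of record satisfies `famV = famX.toVarProblem` BY CONSTRUCTION (`rfl`).
* §4 CENSUS ∕ GUARDS (₁₀CB10YZ): `provisos₁₀_updXYZ ∕ datumOfRecord₁₀_updXYZ` (Stage 10 blind to `X Y Z`); **`exists_record₁₀CB10YZ_faces`** (any admissible `θ` with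
  Stage-10 provisos, `γ > 0`, any floor ∕ `ops` ∕ `ζ` present a record over the SAME datum with `b8` VACUOUS, `b9 ↔ B9LeafX (Y9OfRecord … ops)`,
  `b11 ↔ B11Leaf (Z11OfRecord F N ζ)`); **`b11Leaf_Z11OfRecord_of_s_N07_record₁₀CB10YZ`** (the ∀-form FORCES the leaf at EVERY residual layer — def-Y's junk layer
  closes `b9`), **`thm1_family_of_s_N07_record₁₀CB10YZ`** (… hence Theorem 1 at objects for EVERY regularity datum `R`), **`not_s_N07_record₁₀CB10YZ`** (FALSE relative
  to one record: `CarriersZ.exists_residZ_not_b11Leaf`), `exists_record₁₀CB10YZ_not_b11_main`, `exists_record₁₀CB10YZ_b11_main_iff_leaf` (at the junk-ops records N07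
  IS EXACTLY the leaf at the bundle of record — GENUINE at objects for `k ≥ 1`, NOT junk-closable through `Z`; the only junk routes to the `∃`-form left are IN-EDGE
  failures — a refuting residual [B8] group `X`, e.g. `B8LeafKnit.not_b8LeafR_halfspace`, or a bad operator layer — located, not constructed).
* §5 THE ₉CB10YZ STOREY: `s_N07_iff_leaves₉CB10YZ`, `s_N07_of_refines₉CB10YZ_of_leaf`, `exists_record₉CB10YZ_faces`, `b11Leaf_Z11OfRecord_of_s_N07_record₉CB10YZ`,
  **`not_s_N07_record₉CB10YZ`** (`_of_params` ∕ relative to one record).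
K0 CENSUS (chair R450 (B), located): NONE of the hypotheses `hχ hω hh hsupp` of n23-b's `Node00.exists_isRecordOfRecord₉C_of_regularity` reads a [B11] Theorem-1 output
(`Exists8 ∕ Unique6 ∕ UkExistsR ∕ UniqueUkOrbitR`) BY NAME (`hh` bounds the averaging density `avgDensity`, [B7]-class; the others are measurability ∕ support clauses).
HONEST FRAMING.  [B11]'s Theorem 1 is proved NOWHERE in the tree for `k ≥ 1` (GAPS G₈a-1∕2; `k = 0`: this seat's `B11Thm1CarrierTLevelZero`); `S_N07` is closed ONLY
from displayed slots; N07 is NOT discharged (5∕27 untouched); RIDER №22 and F8 («do not pin (9)–(10) with the axial gauge») stand; one finite four-torus programme at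
fixed `ε` — NOT ℝ⁴, NOT infinite volume, NOT OS, NOT a mass gap, NOT Clay.  Restate-immune (no `def`).
-/

noncomputable section

namespace Summit.QuantumFields.YangMills.BalabanUVNodes.N07AtRecordCarriersZ

open Literature.MathematicalPhysics.QuantumFieldTheory.Balaban1983to89
open Literature.MathematicalPhysics.QuantumFieldTheory.Balaban1983to89.T4Continuum (T4Family FiniteEpsData)
open Literature.MathematicalPhysics.QuantumFieldTheory.Balaban1983to89.DagBinding
open Literature.MathematicalPhysics.QuantumFieldTheory.Balaban1983to89.Node00
open Literature.MathematicalPhysics.QuantumFieldTheory.Balaban1983to89.B11Thm1 (Thm1At Exists8 Unique6 Reg910)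
open Literature.MathematicalPhysics.QuantumFieldTheory.Balaban1983to89.B11Thm1CarrierT (RegCarrierT varProblemT)
open Literature.MathematicalPhysics.QuantumFieldTheory.Balaban1983to89.B12GaugeOrbits021 (OrbitRel)
open YMDAG.UVSplit (RecordPred Datum AtRecord S_N07)
open Summit.QuantumFields.YangMills.BalabanUVNodes.N06AtRecord9CB10Y (exists_junkOps_b9LeafX_Y9OfRecord)
open scoped Matrix.Norms.L2Operator

variable {N : ℕ} [NeZero N]

/-! ## §1 Readings at the cumulative Stage-10 record `IsRecordOfRecord₁₀CB10YZ` -/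

section Record
variable {F : T4Family} {D : FiniteEpsData F (Node00.SU N)} {w : WorldP}

/-- **At a ₁₀CB10YZ record N07 IS «b8 → b9 → b11»** (the in-edges `b5 b6 b7` — and `b4` — are theorems of the record: this seat's
`B11LeafUnpinnedRecord.b11_main_iff_of_isRecordOfRecord₅C` along g30's `atWorld_of_isRecordOfRecord₁₀CB10YZ`). [cite: Balaban1985Variational, Thm 1 p.279, Props 2–9 pp.281–309 (bookkeeping: the node at a record)] -/
theorem b11_main_iff_leaves_of_isRecordOfRecord₁₀CB10YZ (h : IsRecordOfRecord₁₀CB10YZ F N D w) (P : B12.RunParams) :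
    Dag.B11_main (leavesP w P) ↔ ((leavesP w P).b8 → (leavesP w P).b9 → (leavesP w P).b11) :=
  atWorld_of_isRecordOfRecord₁₀CB10YZ (X := fun ℓ => Dag.B11_main ℓ ↔ (ℓ.b8 → ℓ.b9 → ℓ.b11))
    (fun _ _ h5 P => B11LeafUnpinnedRecord.b11_main_iff_of_isRecordOfRecord₅C h5 P) h P

/-- **THE [B11] LEAF AT THE BUNDLE OF RECORD IS THEOREM 1 AT NODE 00's OBJECTS ∧ THE NINE PRINTED PARTS**: `B11Leaf (Z11OfRecord F N ζ)` ⟺ (ONE block of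
constants `C` with `B11Thm1.Thm1At C` at EVERY member `varProblemT F N K k (ζ.R ⟨K, k, _⟩)` — (2), (3), (7), «minimal orbit in (8)», «unique critical orbit in (6)»
read OBJECTS in readings D-n07a-2 ∕ D-n07a-1 («residual orbit»), (9)–(10) read `ζ.R`) ∧ Props 2–6 over `ζ.famLG` ∧ Props 7, 8, Sect. F over `famXOfRecord F N ζ` ∧ Prop 9 over `ζ.famAn`. [cite: Balaban1985Variational, Thm 1 p.279, Props 2–9 pp.281–309] -/
theorem b11Leaf_Z11OfRecord_iff (ζ : ResidZ F N) :
    B11Leaf (Z11OfRecord F N ζ) ↔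
      (∃ C : B11Thm1.Consts, ∀ i : ZIdx, Thm1At C (varProblemT F N i.K i.k (ζ.R i))) ∧
      B11.Prop2Printed ζ.B₁ ζ.B₃ ζ.C₁ ζ.c₁ ζ.famLG ∧ B11.Prop3Printed ζ.C₁ ζ.B₃ ζ.C₂ ζ.C₃ ζ.B₀ ζ.c1h ζ.c₄ ζ.δ₀ ζ.famLG ∧
      B11.Prop4Printed ζ.C₁ ζ.B₃ ζ.famLG ∧ B11.Prop5Printed ζ.B₁ ζ.B₃ ζ.C₁ ζ.famLG ∧ B11.Prop6Printed ζ.B₀ ζ.B₃ ζ.C₁ ζ.famLG ∧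
      B11.Prop7Printed ζ.B₃ ζ.C₁ (famXOfRecord F N ζ) ∧ B11.Prop8Printed ζ.B₃ (famXOfRecord F N ζ) ∧ B11.SectFPrinted ζ.B₃ (famXOfRecord F N ζ) ∧
      B11.Prop9Printed ζ.B₅ ζ.C₁ ζ.β₀ ζ.δ₀ ζ.famAn := by
  refine ⟨fun h => ⟨exists_thm1At_of_b11Leaf_Z11OfRecord h, h.p2, h.p3, h.p4, h.p5, h.p6, h.p7, h.p8, h.sF, h.p9⟩,
    fun ⟨h1, p2, p3, p4, p5, p6, p7, p8, sF, p9⟩ => ⟨?_, p2, p3, p4, p5, p6, p7, p8, sF, p9⟩⟩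
  exact (B11Thm1CarrierT.thm1Printed_iff_thm1At (fun i : ZIdx => i.K) (fun i => i.k) ζ.R).2 h1

end Record

/-- **`S_N07` over ₁₀CB10YZ IS «`b8 → b9 → b11` at every run of every record»**. [cite: Balaban1985Variational, Thm 1 p.279, Props 2–9 pp.281–309 (bookkeeping)] -/
theorem s_N07_iff_leaves₁₀CB10YZ :
    S_N07 (fun F D w => IsRecordOfRecord₁₀CB10YZ F N D w) ↔
      ∀ (F : T4Family) (D : Datum F N) (w : WorldP), IsRecordOfRecord₁₀CB10YZ F N D w →
        ∀ P : B12.RunParams, (leavesP w P).b8 → (leavesP w P).b9 → (leavesP w P).b11 :=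
  ⟨fun h F D w hR P => (b11_main_iff_leaves_of_isRecordOfRecord₁₀CB10YZ hR P).1 (h F D w hR P),
    fun h F D w hR P => (b11_main_iff_leaves_of_isRecordOfRecord₁₀CB10YZ hR P).2 (h F D w hR P)⟩

/-! ## §2 Keyed closers BY NAME -/

/-- **`S_N07 (₁₀CB10YZ)` FROM THE LEAF SLOT, PACKAGE FORM**: if for every record and every package `(θ, h, M⋆, ops, ζ)` PRESENTING it the [B11] leaf holds at the
bundle of record `Z11OfRecord F N ζ`, then `S_N07` over ₁₀CB10YZ (in-edges unused; the slot quantifies over the HIDDEN residual layer — §4 says what the ∀-form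
costs). [cite: Balaban1985Variational, Thm 1 p.279, Props 2–9 pp.281–309 (bookkeeping)] -/
theorem s_N07_record₁₀CB10YZ_of_leafSlot
    (hslot : ∀ (F : T4Family) (D : Datum F N) (w : WorldP), IsRecordOfRecord₁₀CB10YZ F N D w →
      ∀ (θ : Stage9Params F N) (hP : θ.Provisos₁₀) (Mstar : ℕ) (ops : OpsY N θ.toStage3Params Mstar) (ζ : ResidZ F N), θ.Admissible →
        D = datumOfRecord₁₀ F N θ hP → (∀ P, w.up P = upOfRecord₅C F N (θ.view₁₀B10YZ F N Mstar ops ζ) P) → B11Leaf (Z11OfRecord F N ζ)) :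
    S_N07 (fun F D w => IsRecordOfRecord₁₀CB10YZ F N D w) := by
  intro F D w h P
  have hs := hslot F D w h
  obtain ⟨θ, hP, Mstar, ops, ζ, hθ, hD, -, -, -, hup⟩ := h
  intro _ _ _ _ _
  show (w.up P).b11
  rw [hup P]
  exact (upOfRecord₅C_view₁₀B10YZ_leaves F N θ Mstar ops ζ P).1.2 (hs θ hP Mstar ops ζ hθ hD hup)

/-- **`S_N07 (₁₀CB10YZ)` FROM THE LEAF SLOT, BUNDLE FORM**: the [B11] leaf at the bundle of record of EVERY residual layer gives the ∀-form (what a proof of the ∀-form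
must supply — §4 `b11Leaf_Z11OfRecord_of_s_N07_record₁₀CB10YZ` is the converse and `not_s_N07_record₁₀CB10YZ` says the hypothesis is FALSE: the ∀-form over ₁₀CB10YZ is
NOT an N07 target). [cite: Balaban1985Variational, Thm 1 p.279, Props 2–9 pp.281–309 (bookkeeping)] -/
theorem s_N07_record₁₀CB10YZ_of_bundleSlot (hslot : ∀ (F : T4Family) (ζ : ResidZ F N), B11Leaf (Z11OfRecord F N ζ)) :
    S_N07 (fun F D w => IsRecordOfRecord₁₀CB10YZ F N D w) :=
  s_N07_record₁₀CB10YZ_of_leafSlot fun F _ _ _ _ _ _ _ ζ _ _ _ => hslot F ζ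

/-- **THE REPAIR SHAPE ONE STOREY UP**: `S_N07 Rec` for every record predicate `Rec` that (i) refines ₁₀CB10YZ and (ii) carries the world's own `b11` leaf at every run
— what a FURTHER pin (regularity data `R` from genuine cubes, F8, and Theorem 1 PROVED at NODE 00's objects) supplies. [cite: Balaban1985Variational, Thm 1 p.279, Props 2–9 pp.281–309 (bookkeeping: the pinned socket)] -/
theorem s_N07_of_refines₁₀CB10YZ_of_leaf (Rec : RecordPred N)
    (href : ∀ (F : T4Family) (D : Datum F N) (w : WorldP), Rec F D w → IsRecordOfRecord₁₀CB10YZ F N D w)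
    (hleaf : ∀ (F : T4Family) (D : Datum F N) (w : WorldP), Rec F D w → ∀ P : B12.RunParams, (leavesP w P).b11) : S_N07 Rec :=
  fun F D w hR P => (b11_main_iff_leaves_of_isRecordOfRecord₁₀CB10YZ (href F D w hR) P).2 fun _ _ => hleaf F D w hR P

section Letters
variable {F : T4Family}

/-- **Theorem 1 AT GIVEN CONSTANTS at member `(K, k)` FROM def-B's solvability letter at the (2)-class** `UkExistsR F N (regB11 F N) K k (B₃ε₁) V` (G₈a-1) + the
socket's uniqueness clause in (6) + (9)–(10) — (8) in NODE 00's Stage-₈ currency (F7 bridge `B11Thm1CarrierTReg.exists8_iff_ukExistsR` backwards). [cite: Balaban1985Variational, Thm 1 (8) p.279; Balaban1987RG1, (1.1) p.260] -/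
theorem thm1At_varProblemT_of_letters {K k : ℕ} (R : RegCarrierT F N K) (C : B11Thm1.Consts)
    (h : ∀ ε₁ : ℝ, 0 < ε₁ → ε₁ ≤ C.a₁ → ∀ V : GaugeField (F.P K) k (SU N), PlaqSmall ε₁ V →
      UkExistsR F N (regB11 F N) K k (C.B₃ * ε₁) V ∧ Unique6 (varProblemT F N K k R) C.a₀ C.B₃ ε₁ V ∧
        Reg910 (varProblemT F N K k R) C.B₃ C.B₄ ε₁ (C.Mfun ε₁) V) :
    Thm1At C (varProblemT F N K k R) := fun ε₁ h₁ h₂ V hV =>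
  let ⟨h8, h6, h9⟩ := h ε₁ h₁ h₂ V hV
  ⟨(B11Thm1CarrierTReg.exists8_iff_ukExistsR R C.B₃ ε₁ V).2 h8, h6, h9⟩

/-- **WHAT `S_N07 Rec` FEEDS THE STAGE-₈ LAYER, BY NAME**: for `Rec` refining ₁₀CB10YZ, at every `Rec`-record and run whose in-edge leaves `b8`, `b9` hold, def-B's
letters `UkExistsR ∧ UniqueUkOrbitR F N (regB11 F N)` hold on every torus, level `k ≤ K`, radius `B₃ε₁`, `0 < ε₁ ≤ a₁`, every `V` with (7), ONE block of constants
(g30's `G8a_of_leaf_b11_of_isRecordOfRecord₁₀CB10YZ`). [cite: Balaban1985Variational, Thm 1 p.279; Balaban1987RG1, (1.1)–(1.2) p.260] -/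
theorem G8a_of_s_N07 (Rec : RecordPred N) (href : ∀ (F : T4Family) (D : Datum F N) (w : WorldP), Rec F D w → IsRecordOfRecord₁₀CB10YZ F N D w)
    (hS : S_N07 Rec) {D : Datum F N} {w : WorldP} (hR : Rec F D w) {P : B12.RunParams} (h8 : (leavesP w P).b8) (h9 : (leavesP w P).b9) :
    ∃ C : B11Thm1.Consts, ∀ (K k : ℕ), k ≤ K → ∀ ε₁ : ℝ, 0 < ε₁ → ε₁ ≤ C.a₁ → ∀ V : GaugeField (F.P K) k (SU N), PlaqSmall ε₁ V →
      UkExistsR F N (regB11 F N) K k (C.B₃ * ε₁) V ∧ UniqueUkOrbitR F N (regB11 F N) K k (C.B₃ * ε₁) V :=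
  G8a_of_leaf_b11_of_isRecordOfRecord₁₀CB10YZ (href F D w hR)
    ((b11_main_iff_leaves_of_isRecordOfRecord₁₀CB10YZ (href F D w hR) P).1 (hS F D w hR P) h8 h9)

end Letters

/-! ## §3 The knit at the bundle of record: print's «Thm 1 ⇐ Props 7, 8, Sect. F» with the dictionary reduced at NODE 00's objects -/

section Knit
variable {F : T4Family}

/-- **PRINT's DICTIONARY `B11.VarProblemX.Laws` AT A MEMBER OF THE FAMILY OF RECORD, REDUCED AT OBJECTS**: (i) «`𝔘_k(e) ⊂ 𝔘_k(e′)`, `e ≤ e′`» is `inUkClassB11_mono`;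
(iii) «a minimiser over `𝔘_k(e′) ∩ 𝔅_k(V)` lying in `𝔘_k(e)` minimises there» is `isBackground_of_subset_of_mem` for `e ≤ e′`; (ii)'s membership clauses and (iv)'s
orbit clause read the minimiser itself (`OrbitRel.symm`).  RESIDUAL, displayed: «minimal ⇒ critical» for the layer's criticality predicate `ζ.IsCrit` (`hcrit`) and the
LOCAL-minimum half of (iii), `e′ < e` (`hloc`, DIVERGENCE D-B11-2: p. 299 «A′ = 0 is a minimum»). [cite: Balaban1985Variational, (2)–(6) p.278, pp.299–305 (the dictionary of Props 7–8 ∕ Sect. F)] -/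
theorem laws_famXOfRecord (ζ : ResidZ F N) (i : ZIdx)
    (hcrit : ∀ (e : ℝ) (V : GaugeField (F.P i.K) i.k (SU N)) (U : GaugeField (F.P i.K) 0 (SU N)),
      IsBackground (avOfRecord F N i.K) {U | InUkClassB11 F N i.K i.k e U} i.k V U → ζ.IsCrit i V U)
    (hloc : ∀ (e e' : ℝ) (V : GaugeField (F.P i.K) i.k (SU N)) (U : GaugeField (F.P i.K) 0 (SU N)), e' < e →
      IsBackground (avOfRecord F N i.K) {U | InUkClassB11 F N i.K i.k e' U} i.k V U →
        IsBackground (avOfRecord F N i.K) {U | InUkClassB11 F N i.K i.k e U} i.k V U) :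
    (famXOfRecord F N ζ i).Laws := by
  refine ⟨fun e e' U hle hU => B11Thm1CarrierTLevelZero.inUkClassB11_mono hle hU, fun e V U hU => ⟨hcrit e V U hU, hU.2.1, hU.1⟩,
    fun e e' V U hmin hIn => ?_, fun ε₀ V U hIn hB _ hall => ⟨hIn, hB, fun U' hU' => ?_⟩⟩
  · rcases le_or_gt e e' with hle | hlt
    · exact B11Thm1CarrierT.isBackground_of_subset_of_mem hmin
        (fun U'' (hU'' : InUkClassB11 F N i.K i.k e U'') => B11Thm1CarrierTLevelZero.inUkClassB11_mono hle hU'') hIn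
    · exact hloc e e' V U hlt hmin
  · exact (hall U' hU'.2.1 hU'.1 (hcrit ε₀ V U' hU')).symm

/-- **THE [B11] LEAF AT THE BUNDLE OF RECORD FROM NINE PRINTED PARTS — THEOREM 1 DERIVED** (p. 281 «This will prove Theorem 1 …», p. 304 «Now we define a₁ …»;
r2's `B11.thm1_of_prop7_prop8_sectF` BY NAME): the bundle of record satisfies the carrier identity `famV = fun i ↦ (famX i).toVarProblem` BY CONSTRUCTION (`rfl`), so
Props 2–9 and Sect. F at `ζ`'s families and constants, the two residual laws of `laws_famXOfRecord` at every member, `0 < B₃`, `0 < C₁` give the whole leaf — what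
remains displayed is EXACTLY the printed statements over the residual families. [cite: Balaban1985Variational, Thm 1 p.279, Props 2–9 pp.281–309; p.281; p.304] -/
theorem b11Leaf_Z11OfRecord_of_parts (ζ : ResidZ F N) (hB₃ : 0 < ζ.B₃) (hC₁ : 0 < ζ.C₁)
    (hcrit : ∀ (i : ZIdx) (e : ℝ) (V : GaugeField (F.P i.K) i.k (SU N)) (U : GaugeField (F.P i.K) 0 (SU N)),
      IsBackground (avOfRecord F N i.K) {U | InUkClassB11 F N i.K i.k e U} i.k V U → ζ.IsCrit i V U)
    (hloc : ∀ (i : ZIdx) (e e' : ℝ) (V : GaugeField (F.P i.K) i.k (SU N)) (U : GaugeField (F.P i.K) 0 (SU N)), e' < e →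
      IsBackground (avOfRecord F N i.K) {U | InUkClassB11 F N i.K i.k e' U} i.k V U →
        IsBackground (avOfRecord F N i.K) {U | InUkClassB11 F N i.K i.k e U} i.k V U)
    (p2 : B11.Prop2Printed ζ.B₁ ζ.B₃ ζ.C₁ ζ.c₁ ζ.famLG) (p3 : B11.Prop3Printed ζ.C₁ ζ.B₃ ζ.C₂ ζ.C₃ ζ.B₀ ζ.c1h ζ.c₄ ζ.δ₀ ζ.famLG)
    (p4 : B11.Prop4Printed ζ.C₁ ζ.B₃ ζ.famLG) (p5 : B11.Prop5Printed ζ.B₁ ζ.B₃ ζ.C₁ ζ.famLG) (p6 : B11.Prop6Printed ζ.B₀ ζ.B₃ ζ.C₁ ζ.famLG)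
    (p7 : B11.Prop7Printed ζ.B₃ ζ.C₁ (famXOfRecord F N ζ)) (p8 : B11.Prop8Printed ζ.B₃ (famXOfRecord F N ζ))
    (sF : B11.SectFPrinted ζ.B₃ (famXOfRecord F N ζ)) (p9 : B11.Prop9Printed ζ.B₅ ζ.C₁ ζ.β₀ ζ.δ₀ ζ.famAn) :
    B11Leaf (Z11OfRecord F N ζ) where
  t1 := B11.thm1_of_prop7_prop8_sectF (famXOfRecord F N ζ) ζ.B₃ ζ.C₁ hB₃ hC₁ (fun i => laws_famXOfRecord ζ i (hcrit i) (hloc i)) p7 p8 sF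
  p2 := p2
  p3 := p3
  p4 := p4
  p5 := p5
  p6 := p6
  p7 := p7
  p8 := p8
  sF := sF
  p9 := p9

end Knit

/-! ## §4 Census ∕ guards at ₁₀CB10YZ — why the ∀-form over the cumulative record is not a discharge target -/

section Guards
variable {F : T4Family}

/-- The Stage-10 provisos (incl. the β-version proviso `contT`, which reads `ν` only) are blind to the residual carrier families `X`, `Y`, `Z` (field by field; the
₁₀ twin of n10-a's `B13ResidualSlotProbe9.provisos_updXYZ₉`). [cite: Balaban1988Convergent, (3.2)–(3.9) pp.265–266; Balaban1987RG1, (0.19) p.255 (the provisos' dictionary; bookkeeping)] -/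
theorem provisos₁₀_updXYZ {θ : Stage9Params F N} (h : θ.Provisos₁₀) (X' : B12.RunParams → PrintedCarriersR)
    (Y' : B12.RunParams → PrintedCarriers9X) (Z' : B12.RunParams → PrintedCarriers11) :
    ({ θ with res := { θ.res with X := X', Y := Y', Z := Z' } } : Stage9Params F N).Provisos₁₀ :=
  ⟨h.intPiece, h.measω, h.measChi, h.zetaUnity, h.zetaAbs, fun p k _ hk => h.rstep p k hk, h.contT⟩

/-- … and so is the Stage-10 DATUM (`rfl`). [cite: Balaban1988Convergent, (0.2) p.244 and (2.18) p.257 (the datum's dictionary; bookkeeping)] -/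
theorem datumOfRecord₁₀_updXYZ (θ : Stage9Params F N) (h : θ.Provisos₁₀) (X' : B12.RunParams → PrintedCarriersR)
    (Y' : B12.RunParams → PrintedCarriers9X) (Z' : B12.RunParams → PrintedCarriers11) :
    datumOfRecord₁₀ F N ({ θ with res := { θ.res with X := X', Y := Y', Z := Z' } } : Stage9Params F N) (provisos₁₀_updXYZ h X' Y' Z') =
      datumOfRecord₁₀ F N θ h := rfl

/-- **A WORLD PRESENTED BY A GIVEN OPERATOR LAYER AND A GIVEN RESIDUAL [B11] LAYER, in-edge `b8` VACUOUS**: every admissible Stage-9 parameter `θ` with Stage-10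
provisos and `γ > 0`, ANY floor, operator layer `ops` and residual layer `ζ` present a ₁₀CB10YZ record over the SAME datum `datumOfRecord₁₀ θ h` (parameters
re-keyed to EMPTY [B8] indices — `B11LeafUnpinnedRecord.b8LeafR_of_isEmpty` —, bound over `view₁₀B10YZ`) at every run of which `b8` HOLDS,
`b9 ↔ B9LeafX (Y9OfRecord N θ₃ M⋆ ops)` and `b11 ↔ B11Leaf (Z11OfRecord F N ζ)`. [cite: Balaban1985Variational, Thm 1 p.279; Balaban1985BackgroundPropagators, Thm 3.1 p.397; Balaban1985RegularSpaces, Lemma 1 – Thm 8 pp.79–101 (bookkeeping: the record's faces, the [B8] group residual)] -/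
theorem exists_record₁₀CB10YZ_faces (θ : Stage9Params F N) (h : θ.Provisos₁₀) (hθ : θ.Admissible) (hγ : 0 < θ.γ) (Mstar : ℕ)
    (ops : OpsY N θ.toStage3Params Mstar) (ζ : ResidZ F N) :
    ∃ w : WorldP, IsRecordOfRecord₁₀CB10YZ F N (datumOfRecord₁₀ F N θ h) w ∧ ∀ P : B12.RunParams,
      (leavesP w P).b8 ∧ ((leavesP w P).b9 ↔ B9LeafX (Y9OfRecord N θ.toStage3Params Mstar ops)) ∧
        ((leavesP w P).b11 ↔ B11Leaf (Z11OfRecord F N ζ)) := by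
  let X' : B12.RunParams → PrintedCarriersR := fun P =>
    { θ.res.X P with
      I8a := PEmpty, I8b := PEmpty, I8c := PEmpty, I8d := PEmpty, loc8 := fun i => i.elim, fam8 := fun i => i.elim,
      lan8 := fun i => i.elim, cub8 := fun i => i.elim, toAxial8 := fun i => i.elim, C140 := fun i => i.elim, InR := fun i => i.elim,
      proj140 := fun i => i.elim }
  let θ' : Stage9Params F N := { θ with res := { θ.res with X := X', Y := θ.res.Y, Z := θ.res.Z } }
  have h' : θ'.Provisos₁₀ := provisos₁₀_updXYZ h X' θ.res.Y θ.res.Z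
  have hθ' : θ'.Admissible := B13ResidualSlotProbe9.admissible_updXYZ₉ hθ X' θ.res.Y θ.res.Z
  have hD : datumOfRecord₁₀ F N θ' h' = datumOfRecord₁₀ F N θ h := datumOfRecord₁₀_updXYZ θ h X' θ.res.Y θ.res.Z
  obtain ⟨w₀⟩ := nonempty_worldP
  refine ⟨{ w₀ with
      C := (datumOfRecord₁₀ F N θ' h').C, γ := θ.γ, L := (θ.L : ℝ), one_lt_L := by exact_mod_cast θ.hL.2,
      up := fun P => upOfRecord₅C F N (θ'.view₁₀B10YZ F N Mstar ops ζ) P }, ?_, fun P => ?_⟩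
  · rw [← hD]
    exact isRecordOfRecord₁₀CB10YZ_of_eq F N θ' h' hθ' Mstar ops ζ _ rfl ⟨hγ, le_rfl⟩ rfl (fun _ => rfl)
  · have hl := upOfRecord₅C_view₁₀B10YZ_leaves F N θ' Mstar ops ζ P
    refine ⟨?_, hl.2.1, hl.1⟩
    exact (B11LeafUnpinnedRecord.upOfRecord₅C_b8_b9_b11 (θ'.view₁₀B10YZ F N Mstar ops ζ) P).1.2
      (@B11LeafUnpinnedRecord.b8LeafR_of_isEmpty _ _ _ _ (inferInstance : IsEmpty PEmpty) (inferInstance : IsEmpty PEmpty)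
        (inferInstance : IsEmpty PEmpty) (inferInstance : IsEmpty PEmpty) _ _ _ _ _ _ _ _ _ _ _ _ _ _ _)

/-- **THE ∀-FORM FORCES THE [B11] LEAF AT THE BUNDLE OF RECORD OF EVERY RESIDUAL LAYER** (converse of `s_N07_record₁₀CB10YZ_of_bundleSlot` up to the window clause):
at the record of `exists_record₁₀CB10YZ_faces` with def-Y's JUNK operator layer (n22-b's `exists_junkOps_b9LeafX_Y9OfRecord`: `b9` closed content-free) the in-edges
hold, so N07 there IS the leaf. [cite: Balaban1985Variational, Thm 1 p.279, Props 2–9 pp.281–309 (bookkeeping)] -/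
theorem b11Leaf_Z11OfRecord_of_s_N07_record₁₀CB10YZ (hS : S_N07 (fun F D w => IsRecordOfRecord₁₀CB10YZ F N D w))
    (θ : Stage9Params F N) (h : θ.Provisos₁₀) (hθ : θ.Admissible) (hγ : 0 < θ.γ) (ζ : ResidZ F N) : B11Leaf (Z11OfRecord F N ζ) := by
  obtain ⟨ops, -, hops⟩ := exists_junkOps_b9LeafX_Y9OfRecord (N := N) θ.toStage3Params hθ.1.1.1.1 0
  obtain ⟨w, hw, hl⟩ := exists_record₁₀CB10YZ_faces θ h hθ hγ 0 ops ζ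
  let P₀ : B12.RunParams := ⟨0, 0, 0⟩
  obtain ⟨h8, h9, h11⟩ := hl P₀
  exact h11.1 ((b11_main_iff_leaves_of_isRecordOfRecord₁₀CB10YZ hw P₀).1 (hS F _ w hw P₀) h8 (h9.2 hops))

/-- **… HENCE THE ∀-FORM ASSERTS THEOREM 1 AT NODE 00's OBJECTS FOR EVERY RESIDUAL REGULARITY DATUM `R`** — degenerate data (one never-gaugeable cube) included,
which is absurd (next theorem). [cite: Balaban1985Variational, Thm 1 (9)–(10) p.279 (bookkeeping: the typed regularity clause reads residual data)] -/
theorem thm1_family_of_s_N07_record₁₀CB10YZ (hS : S_N07 (fun F D w => IsRecordOfRecord₁₀CB10YZ F N D w))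
    (θ : Stage9Params F N) (h : θ.Provisos₁₀) (hθ : θ.Admissible) (hγ : 0 < θ.γ) (R : ∀ i : ZIdx, RegCarrierT F N i.K) :
    ∃ C : B11Thm1.Consts, ∀ i : ZIdx, Thm1At C (varProblemT F N i.K i.k (R i)) := by
  obtain ⟨ζ₀⟩ := nonempty_residZ F N
  exact exists_thm1At_of_b11Leaf_Z11OfRecord (b11Leaf_Z11OfRecord_of_s_N07_record₁₀CB10YZ hS θ h hθ hγ { ζ₀ with R := R })

/-- **`S_N07` AT `Rec := IsRecordOfRecord₁₀CB10YZ` IS FALSE as soon as ONE admissible Stage-9 parameter with Stage-10 provisos and `γ > 0` exists** (any family):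
g30's refuting residual layer `CarriersZ.exists_residZ_not_b11Leaf`.  So K3's `h7 : S_N07 Rec` is NOT to be instantiated at the cumulative record in ∀-form; the value
of the pin is «Theorem 1's family = NODE 00's objects, by name» (§1–§3); the next pin is `R` from genuine cubes (F8). [cite: Balaban1985Variational, Thm 1 p.279 (bookkeeping: the universal form over the cumulative record is refutable through the residual layer)] -/
theorem not_s_N07_record₁₀CB10YZ_of_params (θ : Stage9Params F N) (h : θ.Provisos₁₀) (hθ : θ.Admissible) (hγ : 0 < θ.γ) :
    ¬ S_N07 (fun F D w => IsRecordOfRecord₁₀CB10YZ F N D w) := fun hS => by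
  obtain ⟨ζ, hζ⟩ := exists_residZ_not_b11Leaf F N
  exact hζ (b11Leaf_Z11OfRecord_of_s_N07_record₁₀CB10YZ hS θ h hθ hγ ζ)

variable {D : FiniteEpsData F (Node00.SU N)} {w : WorldP}

/-- **Given ONE ₁₀CB10YZ record, a ₁₀CB10YZ record over the SAME datum at every run of which `b8`, `b9` HOLD and N07 FAILS** (junk operator layer, refuting residual
[B11] layer, empty [B8] indices). [cite: Balaban1985Variational, Thm 1 p.279 (bookkeeping over NODE 00's cumulative record)] -/
theorem exists_record₁₀CB10YZ_not_b11_main (hR : IsRecordOfRecord₁₀CB10YZ F N D w) :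
    ∃ w' : WorldP, IsRecordOfRecord₁₀CB10YZ F N D w' ∧ ∀ P : B12.RunParams, ¬ Dag.B11_main (leavesP w' P) := by
  obtain ⟨θ, h, Mstar, -, -, hθ, hD, -, hγ, -, -⟩ := hR
  obtain ⟨ops, -, hops⟩ := exists_junkOps_b9LeafX_Y9OfRecord (N := N) θ.toStage3Params hθ.1.1.1.1 Mstar
  obtain ⟨ζ, hζ⟩ := exists_residZ_not_b11Leaf F N
  obtain ⟨w', hw', hl⟩ := exists_record₁₀CB10YZ_faces θ h hθ (hγ.1.trans_le hγ.2) Mstar ops ζ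
  refine ⟨w', by rw [hD]; exact hw', fun P hN => ?_⟩
  obtain ⟨h8, h9, h11⟩ := hl P
  exact hζ (h11.1 ((b11_main_iff_leaves_of_isRecordOfRecord₁₀CB10YZ hw' P).1 hN h8 (h9.2 hops)))

/-- **`S_N07` at ₁₀CB10YZ is FALSE relative to ONE ₁₀CB10YZ record** (any family; the record certifies `θ`, its provisos, admissibility and `0 < w.γ ≤ θ.γ` — the
shape of this seat's ₈C census `BalabanUVNodesN07RecordCensus.not_s_N07_record₈C`; K0 is NODE 00's item, not reached for). [cite: Balaban1985Variational, Thm 1 p.279 (bookkeeping)] -/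
theorem not_s_N07_record₁₀CB10YZ (hex : ∃ (F : T4Family) (D : Datum F N) (w : WorldP), IsRecordOfRecord₁₀CB10YZ F N D w) :
    ¬ S_N07 (fun F D w => IsRecordOfRecord₁₀CB10YZ F N D w) := by
  obtain ⟨F, D, w, θ, h, -, -, -, hθ, -, -, hγ, -, -⟩ := hex
  exact not_s_N07_record₁₀CB10YZ_of_params θ h hθ (hγ.1.trans_le hγ.2)

/-- **AT THE JUNK-OPS RECORDS N07 IS EXACTLY THE [B11] LEAF AT THE BUNDLE OF RECORD** (every admissible `θ` with Stage-10 provisos and `γ > 0`, every floor, every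
residual layer `ζ`; a record over the same datum).  Unlike `b9` (def-Y's zero layer) and unlike ₅C ∕ ₈C (`B11LeafUnpinnedRecord.exists_record₈C_b11_main`, empty
index), this right-hand side is NOT junk-closable: its `t1` is Theorem 1 at NODE 00's OBJECTS over the inhabited index `ZIdx` (`k = 0`:
`CarriersZ.famV_levelZero_exists8_unique6`; `k ≥ 1`: Bałaban's theorem, GAPS G₈a-1∕2). [cite: Balaban1985Variational, Thm 1 p.279, Props 2–9 pp.281–309] -/
theorem exists_record₁₀CB10YZ_b11_main_iff_leaf (θ : Stage9Params F N) (h : θ.Provisos₁₀) (hθ : θ.Admissible) (hγ : 0 < θ.γ) (Mstar : ℕ)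
    (ζ : ResidZ F N) :
    ∃ w : WorldP, IsRecordOfRecord₁₀CB10YZ F N (datumOfRecord₁₀ F N θ h) w ∧
      ∀ P : B12.RunParams, Dag.B11_main (leavesP w P) ↔ B11Leaf (Z11OfRecord F N ζ) := by
  obtain ⟨ops, -, hops⟩ := exists_junkOps_b9LeafX_Y9OfRecord (N := N) θ.toStage3Params hθ.1.1.1.1 Mstar
  obtain ⟨w, hw, hl⟩ := exists_record₁₀CB10YZ_faces θ h hθ hγ Mstar ops ζ
  refine ⟨w, hw, fun P => ?_⟩
  obtain ⟨h8, h9, h11⟩ := hl P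
  rw [b11_main_iff_leaves_of_isRecordOfRecord₁₀CB10YZ hw P, ← h11]
  exact ⟨fun hN => hN h8 (h9.2 hops), fun hb _ _ => hb⟩

end Guards

/-! ## §5 The ₉CB10YZ storey (`Node00/CarriersZ`'s faces by name) -/

section Stage9
variable {F : T4Family} {D : FiniteEpsData F (Node00.SU N)} {w : WorldP}

/-- **`S_N07` over ₉CB10YZ IS «`b8 → b9 → b11` at every run of every record»** (g30's `b11_main_iff_of_isRecordOfRecord₉CB10YZ`).
[cite: Balaban1985Variational, Thm 1 p.279, Props 2–9 pp.281–309 (bookkeeping)] -/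
theorem s_N07_iff_leaves₉CB10YZ :
    S_N07 (fun F D w => IsRecordOfRecord₉CB10YZ F N D w) ↔
      ∀ (F : T4Family) (D : Datum F N) (w : WorldP), IsRecordOfRecord₉CB10YZ F N D w →
        ∀ P : B12.RunParams, (leavesP w P).b8 → (leavesP w P).b9 → (leavesP w P).b11 :=
  ⟨fun h F D w hR P => (b11_main_iff_of_isRecordOfRecord₉CB10YZ hR P).1 (h F D w hR P),
    fun h F D w hR P => (b11_main_iff_of_isRecordOfRecord₉CB10YZ hR P).2 (h F D w hR P)⟩

/-- **THE REPAIR SHAPE at ₉CB10YZ** (the package-form slot closer is g30's `b11_main_of_isRecordOfRecord₉CB10YZ_of_slots` per record): `S_N07 Rec` for every `Rec`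
refining ₉CB10YZ at which the world's own `b11` leaf holds at every run. [cite: Balaban1985Variational, Thm 1 p.279, Props 2–9 pp.281–309 (bookkeeping: the pinned socket)] -/
theorem s_N07_of_refines₉CB10YZ_of_leaf (Rec : RecordPred N)
    (href : ∀ (F : T4Family) (D : Datum F N) (w : WorldP), Rec F D w → IsRecordOfRecord₉CB10YZ F N D w)
    (hleaf : ∀ (F : T4Family) (D : Datum F N) (w : WorldP), Rec F D w → ∀ P : B12.RunParams, (leavesP w P).b11) : S_N07 Rec :=
  fun F D w hR P => (b11_main_iff_of_isRecordOfRecord₉CB10YZ (href F D w hR) P).2 fun _ _ => hleaf F D w hR P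

/-- **The ₉CB10YZ presentation with `b8` vacuous** (n10-a's Stage-9 blindness lemmas `B13ResidualSlotProbe9.provisos_updXYZ₉ ∕ datumOfRecord₉_updXYZ`): a ₉CB10YZ record
over the SAME datum with `b8` TRUE, `b9 ↔ B9LeafX (Y9OfRecord …)`, `b11 ↔ B11Leaf (Z11OfRecord F N ζ)`. [cite: Balaban1985Variational, Thm 1 p.279; Balaban1985BackgroundPropagators, Thm 3.1 p.397 (bookkeeping: the record's faces)] -/
theorem exists_record₉CB10YZ_faces (θ : Stage9Params F N) (h : θ.Provisos) (hθ : θ.Admissible) (hγ : 0 < θ.γ) (Mstar : ℕ)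
    (ops : OpsY N θ.toStage3Params Mstar) (ζ : ResidZ F N) :
    ∃ w : WorldP, IsRecordOfRecord₉CB10YZ F N (datumOfRecord₉ F N θ h) w ∧ ∀ P : B12.RunParams,
      (leavesP w P).b8 ∧ ((leavesP w P).b9 ↔ B9LeafX (Y9OfRecord N θ.toStage3Params Mstar ops)) ∧
        ((leavesP w P).b11 ↔ B11Leaf (Z11OfRecord F N ζ)) := by
  let X' : B12.RunParams → PrintedCarriersR := fun P =>
    { θ.res.X P with
      I8a := PEmpty, I8b := PEmpty, I8c := PEmpty, I8d := PEmpty, loc8 := fun i => i.elim, fam8 := fun i => i.elim,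
      lan8 := fun i => i.elim, cub8 := fun i => i.elim, toAxial8 := fun i => i.elim, C140 := fun i => i.elim, InR := fun i => i.elim,
      proj140 := fun i => i.elim }
  let θ' : Stage9Params F N := { θ with res := { θ.res with X := X', Y := θ.res.Y, Z := θ.res.Z } }
  have h' : θ'.Provisos := B13ResidualSlotProbe9.provisos_updXYZ₉ h X' θ.res.Y θ.res.Z
  have hθ' : θ'.Admissible := B13ResidualSlotProbe9.admissible_updXYZ₉ hθ X' θ.res.Y θ.res.Z
  have hD : datumOfRecord₉ F N θ' h' = datumOfRecord₉ F N θ h := B13ResidualSlotProbe9.datumOfRecord₉_updXYZ θ h X' θ.res.Y θ.res.Z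
  obtain ⟨w₀⟩ := nonempty_worldP
  refine ⟨{ w₀ with
      C := (datumOfRecord₉ F N θ' h').C, γ := θ.γ, L := (θ.L : ℝ), one_lt_L := by exact_mod_cast θ.hL.2,
      up := fun P => upOfRecord₅C F N (θ'.viewB10YZ F N Mstar ops ζ) P }, ?_, fun P => ?_⟩
  · rw [← hD]
    exact isRecordOfRecord₉CB10YZ_of_eq F N θ' h' hθ' Mstar ops ζ _ rfl ⟨hγ, le_rfl⟩ rfl (fun _ => rfl)
  · have hl := upOfRecord₅C_viewB10YZ_leaves F N θ' Mstar ops ζ P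
    refine ⟨?_, hl.2.1, hl.1⟩
    exact (B11LeafUnpinnedRecord.upOfRecord₅C_b8_b9_b11 (θ'.viewB10YZ F N Mstar ops ζ) P).1.2
      (@B11LeafUnpinnedRecord.b8LeafR_of_isEmpty _ _ _ _ (inferInstance : IsEmpty PEmpty) (inferInstance : IsEmpty PEmpty)
        (inferInstance : IsEmpty PEmpty) (inferInstance : IsEmpty PEmpty) _ _ _ _ _ _ _ _ _ _ _ _ _ _ _)

/-- **The ∀-form over ₉CB10YZ FORCES the [B11] leaf at the bundle of record of EVERY residual layer** (junk operator layer, `b8` vacuous). [cite: Balaban1985Variational, Thm 1 p.279, Props 2–9 pp.281–309 (bookkeeping)] -/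
theorem b11Leaf_Z11OfRecord_of_s_N07_record₉CB10YZ (hS : S_N07 (fun F D w => IsRecordOfRecord₉CB10YZ F N D w))
    (θ : Stage9Params F N) (h : θ.Provisos) (hθ : θ.Admissible) (hγ : 0 < θ.γ) (ζ : ResidZ F N) : B11Leaf (Z11OfRecord F N ζ) := by
  obtain ⟨ops, -, hops⟩ := exists_junkOps_b9LeafX_Y9OfRecord (N := N) θ.toStage3Params hθ.1.1.1.1 0
  obtain ⟨w, hw, hl⟩ := exists_record₉CB10YZ_faces θ h hθ hγ 0 ops ζ
  let P₀ : B12.RunParams := ⟨0, 0, 0⟩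
  obtain ⟨h8, h9, h11⟩ := hl P₀
  exact h11.1 ((b11_main_iff_of_isRecordOfRecord₉CB10YZ hw P₀).1 (hS F _ w hw P₀) h8 (h9.2 hops))

/-- **`S_N07` AT `Rec := IsRecordOfRecord₉CB10YZ` IS FALSE as soon as ONE admissible Stage-9 parameter with provisos and `γ > 0` exists** (any family).
[cite: Balaban1985Variational, Thm 1 p.279 (bookkeeping: the universal form over the cumulative Stage-9 record is refutable through the residual layer)] -/
theorem not_s_N07_record₉CB10YZ_of_params (θ : Stage9Params F N) (h : θ.Provisos) (hθ : θ.Admissible) (hγ : 0 < θ.γ) :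
    ¬ S_N07 (fun F D w => IsRecordOfRecord₉CB10YZ F N D w) := fun hS => by
  obtain ⟨ζ, hζ⟩ := exists_residZ_not_b11Leaf F N
  exact hζ (b11Leaf_Z11OfRecord_of_s_N07_record₉CB10YZ hS θ h hθ hγ ζ)

/-- **`S_N07` at ₉CB10YZ is FALSE relative to ONE ₉CB10YZ record** (the twin of `BalabanUVNodesN07RecordCensus.not_s_N07_record₈C` one storey up). [cite: Balaban1985Variational, Thm 1 p.279 (bookkeeping)] -/
theorem not_s_N07_record₉CB10YZ (hex : ∃ (F : T4Family) (D : Datum F N) (w : WorldP), IsRecordOfRecord₉CB10YZ F N D w) :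
    ¬ S_N07 (fun F D w => IsRecordOfRecord₉CB10YZ F N D w) := by
  obtain ⟨F, D, w, θ, h, -, -, -, hθ, -, -, hγ, -, -⟩ := hex
  exact not_s_N07_record₉CB10YZ_of_params θ h hθ (hγ.1.trans_le hγ.2)

end Stage9

end Summit.QuantumFields.YangMills.BalabanUVNodes.N07AtRecordCarriersZ

end
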